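import Summits.ResolutionOfSingularities.ResolutionOfSingularities.Theses.WeightedInvariant
import Literature.AlgebraicGeometry.Resolution.ResolutionOfComponents

/-!
# ResolutionOfSingularities / WeightedInvariant — `DescentReducedToIntegral`

Route `ResolutionOfSingularities/WeightedInvariant`, item `stmt-ResolutionOfSingularities-0551`
(support, shared by signature with the routes Descent / pAlteration / UniformComplexity):

*for a fixed field `k` (any characteristic), if every integral separated `k`-scheme of finite
type has a resolution of singularities, then so does every reduced separated `k`-scheme of finite
type.*

Proof (folklore; Cossart–Piltant, arXiv:1412.0868, proof of Prop. 4.6, Step 1): a reduced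
`k`-scheme of finite type is Noetherian, hence has finitely many irreducible components; each,
with its reduced closed-subscheme structure, is an integral closed subscheme `Z ↪ X`, again
separated and of finite type over `k` (compose the closed immersion with `f`), so it has a
resolution by hypothesis; the resolutions glue along the closed cover
(`Literature.AlgebraicGeometry.Resolution.hasResolution_of_forall_closeds`, sorry-free in tree —
this file is the fixed-`k` form of `resolutionInChar_iff_integral` there).
-/

namespace Summit.ResolutionOfSingularities.ResolutionOfSingularities.Theorems

open CategoryTheory AlgebraicGeometry AlgebraicGeometry.Scheme.IdealSheafData

/-- **Reduced ⇒ integral reduction of resolution over a fixed field** (closes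
`stmt-ResolutionOfSingularities-0551`, route decl `WeightedInvariant.DescentReducedToIntegral`):
if every integral separated finite-type `k`-scheme has a resolution, so does every reduced
separated finite-type `k`-scheme — resolve the (finitely many) irreducible components with their
integral closed-subscheme structure and glue
(`Literature.AlgebraicGeometry.Resolution.hasResolution_of_forall_closeds`). [folklore] -/
theorem descentReducedToIntegral_proof :
    Summit.ResolutionOfSingularities.ResolutionOfSingularities.Theses.WeightedInvariant.DescentReducedToIntegral := by
  unfold Theses.WeightedInvariant.DescentReducedToIntegral
  intro k _ h X f _ _ _ _
  refine Literature.AlgebraicGeometry.Resolution.hasResolution_of_forall_closeds X f fun Z hZ => ?_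
  exact h _ ((vanishingIdeal Z).subschemeι ≫ f) inferInstance inferInstance inferInstance hZ

end Summit.ResolutionOfSingularities.ResolutionOfSingularities.Theorems
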